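import Literature.Probability.Percolation.ArmSeparationSlotEvents
import Literature.Probability.Percolation.ArmSeparationSlotArith
import HarnessLib

/-!
# Slot events: the private supports of the two colours are disjoint

Topic: Probability / Percolation; family `crit-perc`. A brick of the discharge of
`Literature.Probability.Percolation.Nolin2008_twoArm_separation` (Nolin 2008, Thm. 11
[arXiv 0711.4948: Thm. 10]; `ArmSeparation.lean`), landing step of the internal extremities
(Nolin 2008, Prop. 12 [arXiv Prop. 11]: Lemma 13 [arXiv Lemma 12] needs the supports `𝒜`,
`𝒜⁺`, `𝒜⁻` pairwise disjoint). For a slot `σ` in range whose windows can hold tips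
(`Slot.Admissible`) and whose tips, when on the same side, are as far apart as two fenced tips of
different colours must be (`Slot.SepOK`, from `int_row_gap_of_lt₂`) — both consequences of
`blackArm σ ∩ whiteArm σ ≠ ∅` (`Slot.admissible_of_mem`, `Slot.sepOK_of_mem`) — the shared support
`sharedFin m (2N)` and the private supports `Pfin σ`, `Mfin σ` (`ArmSeparationSlotEvents.lean`) are
pairwise disjoint (`Slot.disjoint_supports`), under the standing size conditions `LParams.Valid`.
The nine pairs of pieces are separated by norm bands (rings at depths `≈ μ` and `≈ 3μ`, tip
structures at depth `≤ 2k + L`), by sectors (`disjoint_sectorNear`), by the row gap on a common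
side, by the choice of the target rows (`Slot.bo`, `Slot.bc`: danger zones) and by the windows cut
out of the two rings (`mem_arc_compl` with `pos_le_of_side_lat`).

## References

* P. Nolin, *Near-critical percolation in two dimensions*, Electron. J. Probab. 13 (2008), §4.3
  Prop. 12, Lemma 13, §4.4 [arXiv 0711.4948: Prop. 11, Lemma 12, Thm. 10]. [Nolin2008]
* H. Kesten, *Scaling relations for 2D-percolation*, Comm. Math. Phys. 109 (1987), Lemma 2, §2. [Kesten1987]
-/

noncomputable section

open Set

namespace Literature.Probability.Percolation

open LatticeModels HalfAnnulus Tube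

/-! ### Standing size conditions -/

namespace LParams

/-- **Standing size conditions of a rung**: the ladder relation `m = 2n + 1`, a large smallest scale
`k₀ ≥ 64`, the outer radius `N ≥ 2m`, `n ≥ 128`, the depth unit small (`64 μ ≤ n`), the tip margin
between `8μ` and `n/4`. [cite: Nolin2008, §4.4 (arXiv 0711.4948: Thm. 10, internal extremities)] -/
structure Valid (P : LParams) : Prop where
  /-- ladder -/
  hm : P.m = 2 * P.n + 1
  /-- smallest scale -/
  hk₀ : 64 ≤ P.k₀
  /-- outer radius -/
  hN : 2 * P.m ≤ P.N
  /-- target radius -/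
  hn : 128 ≤ P.n
  /-- depth unit -/
  hμn : 64 * P.μ ≤ P.n
  /-- tip margin, below -/
  hR₀ : 8 * P.μ ≤ P.R₀
  /-- tip margin, above -/
  hR₀n : 4 * P.R₀ ≤ P.n

variable {P : LParams}

/-- Every fence scale is at most `μ / 32`. [folklore] -/
theorem scale_le (P : LParams) {j : ℕ} (hj : j < P.K) : 32 * trapScale P.k₀ j ≤ P.μ := by
  unfold LParams.μ
  calc 32 * trapScale P.k₀ j = trapScale P.k₀ (j + 1) := (trapScale_succ _ _).symm
    _ ≤ trapScale P.k₀ P.K := trapScale_mono _ hj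

/-- `k₀ ≤ μ`. [folklore] -/
theorem k₀_le_μ (P : LParams) : P.k₀ ≤ P.μ := le_trapScale _ _

/-- **The numeric facts of a valid rung** used by the separation and the moves. [folklore] -/
theorem Valid.facts (hV : P.Valid) :
    P.s = P.k₀ ∧ P.w = P.k₀ / 4 ∧ P.e = P.k₀ / 4 ∧ P.ε = P.k₀ / 16 ∧ 64 ≤ P.k₀ ∧ P.k₀ ≤ P.μ ∧
      P.rB ≤ P.m - P.μ ∧ P.m - P.μ < P.rB + P.s ∧ P.rW ≤ P.m - 3 * P.μ ∧ P.m - 3 * P.μ < P.rW + P.s ∧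
      P.nB * P.s = P.rB ∧ P.nW * P.s = P.rW ∧ P.m = 2 * P.n + 1 ∧ 2 * P.m ≤ P.N ∧ 128 ≤ P.n ∧ 64 * P.μ ≤ P.n ∧
      8 * P.μ ≤ P.R₀ ∧ 4 * P.R₀ ≤ P.n := by
  have hs : P.s = P.k₀ := rfl
  have hk : 1 ≤ P.k₀ := le_trans (by norm_num) hV.hk₀
  refine ⟨rfl, rfl, rfl, rfl, hV.hk₀, P.k₀_le_μ, ?_, ?_, ?_, ?_, ?_, ?_, hV.hm, hV.hN, hV.hn, hV.hμn, hV.hR₀, hV.hR₀n⟩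
  · unfold LParams.rB; rw [hs]; exact Nat.mul_div_le _ _
  · unfold LParams.rB; rw [hs]; conv_rhs => rw [Nat.mul_comm]
    exact Nat.lt_div_mul_add hk
  · unfold LParams.rW; rw [hs]; exact Nat.mul_div_le _ _
  · unfold LParams.rW; rw [hs]; conv_rhs => rw [Nat.mul_comm]
    exact Nat.lt_div_mul_add hk
  · unfold LParams.nB LParams.rB; rw [hs, Nat.mul_div_cancel_left _ hk, mul_comm]
  · unfold LParams.nW LParams.rW; rw [hs, Nat.mul_div_cancel_left _ hk, mul_comm]

end LParams

/-! ### Slots in range, admissible, separated -/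

namespace Slot

variable (P : LParams) (σ : Slot)

/-- The slot's indices are in range. [folklore] -/
structure InRange : Prop where
  /-- side of the open tip -/
  hio : σ.io < 6
  /-- scale index of the open tip -/
  hjo : σ.jo < P.K
  /-- side of the closed tip -/
  hic : σ.ic < 6
  /-- scale index of the closed tip -/
  hjc : σ.jc < P.K

/-- **Admissible slot**: both windows can hold a tip row `t` with `-m + R₀ ≤ t ≤ -R₀`. [folklore] -/
def Admissible (P' : LParams) (σ' : Slot) : Prop :=
  σ'.To P' ≤ -(P'.R₀ : ℤ) ∧ -(P'.m : ℤ) + P'.R₀ < σ'.To P' + P'.w ∧ σ'.Tc P' ≤ -(P'.R₀ : ℤ) ∧ -(P'.m : ℤ) + P'.R₀ < σ'.Tc P' + P'.w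

/-- **Separated slot**: tips on a common side have windows as far apart as the row gap of two
fenced tips of different colours (`int_row_gap_of_lt₂`). [folklore] -/
def SepOK (P' : LParams) (σ' : Slot) : Prop :=
  σ'.io ≠ σ'.ic ∨ σ'.To P' + 8 * σ'.ko P' < σ'.Tc P' + P'.w ∨ σ'.Tc P' + 8 * σ'.kc P' < σ'.To P' + P'.w

variable {P σ}

/-- A slot holding both arms is admissible. [folklore] -/
theorem admissible_of_mem {ω : SiteConfig (Site 2)} (hω : ω ∈ σ.blackArm P ∩ σ.whiteArm P) : σ.Admissible P := by
  obtain ⟨⟨zo, uo, -, -, Fo, -, h1, h2, -⟩, ⟨zc, uc, -, -, Fc, -, h3, h4, -⟩⟩ := hω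
  have ho : -(P.m : ℤ) + P.R₀ ≤ Fo.z 1 ∧ Fo.z 1 ≤ -(P.R₀ : ℤ) := Fo.z_mid
  have hc : -(P.m : ℤ) + P.R₀ ≤ Fc.z 1 ∧ Fc.z 1 ≤ -(P.R₀ : ℤ) := Fc.z_mid
  exact ⟨by omega, by omega, by omega, by omega⟩

/-- The region of the closed arm consists of sites of norm `≥ m` (`2m ≤ N`, `ic < 6`). [folklore] -/
theorem norm_le_of_mem_whiteRegion {m N ic : ℕ} (hic : ic < 6) (hN : 2 * m ≤ N) {zc : Site 2} (hzc : zc ∈ sepLanding N) :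
    ∀ v ∈ (frameIso ic).symm '' (Neg.neg ⁻¹' (triAnnulusSet m N ∪ triOpenBall zc (N / 8))), (m : ℤ) ≤ triNorm v := by
  rintro v ⟨x, hx, rfl⟩
  rw [show ((frameIso ic).symm : triGraph ≃g triGraph) x = (frameIso ic).symm x from rfl, triNorm_frameIso_symm ic hic,
    ← triNorm_neg]
  exact norm_le_of_mem_extRegion hN hzc (-x) hx

/-- **A slot holding both arms is separated** (`2m ≤ N`, `64 k < m` for all scales, `io < 6`). [cite: Nolin2008, §4.4 (arXiv 0711.4948: Thm. 10, internal extremities: fences of different colours)] -/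
theorem sepOK_of_mem (hN : 2 * P.m ≤ P.N) (hKm : ∀ j < P.K, 64 * trapScale P.k₀ j < P.m) (hio : σ.io < 6)
    {ω : SiteConfig (Site 2)} (hω : ω ∈ σ.blackArm P ∩ σ.whiteArm P) : σ.SepOK P := by
  unfold SepOK
  by_cases hii : σ.io ≠ σ.ic
  · exact Or.inl hii
  right
  push Not at hii
  obtain ⟨⟨zo, uo, hzo, -, Fo, hjo, h1, h2, -⟩, ⟨zc, uc, hzc, -, Fc, hjc, h3, h4, -⟩⟩ := hω
  have hic : σ.ic < 6 := hii ▸ hio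
  have hA := norm_le_of_mem_image_frame_symm hio (norm_le_of_mem_extRegion hN hzo)
  have hB := norm_le_of_mem_whiteRegion (m := P.m) hic hN hzc
  have hko : (Fo.k : ℤ) = σ.ko P := by show ((trapScale P.k₀ Fo.j : ℕ) : ℤ) = trapScale P.k₀ σ.jo; rw [hjo]
  have hkc : (Fc.k : ℤ) = σ.kc P := by show ((trapScale P.k₀ Fc.j : ℕ) : ℤ) = trapScale P.k₀ σ.jc; rw [hjc]
  have hcol : ∀ v, v ∈ (frameConfig σ.ic ω)ᶜ → v ∉ frameConfig σ.io ω := fun v hv hv' => hv (hii ▸ hv')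
  have hcol' : ∀ v, v ∈ frameConfig σ.io ω → v ∉ (frameConfig σ.ic ω)ᶜ := fun v hv hv' => hv' (hii ▸ hv)
  have hne : Fo.z 1 ≠ Fc.z 1 := fun h => by
    have heq : Fo.z = Fc.z := Site.eq_iff_two.2 ⟨by rw [Fo.z_isIntJ.1, Fc.z_isIntJ.1], h⟩
    have h1 : Fo.z ∈ frameConfig σ.ic ω := hii ▸ Fo.z_mem_config
    rw [heq] at h1
    exact Fc.z_mem_config h1
  rcases lt_or_gt_of_ne hne with hlt | hlt
  · have := int_row_gap_of_lt₂ hB hKm hcol Fo Fc hlt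
    left; omega
  · have := int_row_gap_of_lt₂ hA hKm hcol' Fc Fo hlt
    right; omega

end Slot

/-- Index comparison from lateral comparison: `a s ≤ b s + c` with `c < s` forces `a ≤ b` (`0 < s`). [folklore] -/
theorem idx_le_of_mul_le {s a b : ℕ} {c : ℤ} (hs : 0 < s) (h : (a : ℤ) * s ≤ (b : ℤ) * s + c) (hc : c < s) : a ≤ b := by
  by_contra h'
  push Not at h'
  have : (b : ℤ) + 1 ≤ a := by exact_mod_cast h'
  have hs' : (0 : ℤ) < s := by exact_mod_cast hs
  nlinarith

namespace Slot

variable {P : LParams} {σ : Slot}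

/-- Pieces of the sides `0, 1, 3, 4` are listed by increasing lateral index. [folklore] -/
theorem _root_.Literature.Probability.Percolation.piecePos_eq_of_ne {n i ι : ℕ} (h : i % 3 ≠ 2) :
    piecePos n i ι = blockOff n i + 2 * ι := by
  unfold piecePos; rw [if_neg h]

/-- Pieces of the sides `2, 5` are listed by decreasing lateral index. [folklore] -/
theorem _root_.Literature.Probability.Percolation.piecePos_eq_of_two {n i ι : ℕ} (h : i % 3 = 2) :
    piecePos n i ι = blockOff n i + 2 * (n - 1 - ι) := by
  unfold piecePos; rw [if_pos h]

/-- The end (exclusive) of the block of the side `i` in the thin ring with `n` chunks per side. [folklore] -/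
def _root_.Literature.Probability.Percolation.blockEnd (n i : ℕ) : ℕ :=
  match i with
  | 0 => 2 * n - 1
  | 1 => 4 * n - 1
  | 2 => 6 * n - 2
  | 3 => 8 * n - 3
  | 4 => 10 * n - 3
  | _ => 12 * n - 4

/-- The end of a block is the offset of the next one (the ring's length for the last). [folklore] -/
theorem _root_.Literature.Probability.Percolation.blockEnd_eq {n i : ℕ} (hi : i < 6) :
    blockEnd n i = if i = 5 then 12 * n - 4 else blockOff n (i + 1) := by
  interval_cases i <;> simp [blockEnd, blockOff]

/-- **The blocks are ordered**: the block of the side `i` ends before the block of a later side `j`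
begins (`i < j < 6`). [folklore] -/
theorem _root_.Literature.Probability.Percolation.blockEnd_le_blockOff {n i j : ℕ} (hij : i < j) (hj : j < 6) :
    blockEnd n i ≤ blockOff n j := by
  interval_cases j <;> interval_cases i <;> simp only [blockEnd, blockOff] <;> omega

/-- The offset of a block is at most its end. [folklore] -/
theorem _root_.Literature.Probability.Percolation.blockOff_le_blockEnd {n i : ℕ} (hi : i < 6) : blockOff n i ≤ blockEnd n i := by
  interval_cases i <;> simp only [blockEnd, blockOff] <;> omega

/-- A piece of the side `i` lies in the block of the side `i` (`1 ≤ n`, `i < 6`, `ι < n`). [folklore] -/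
theorem _root_.Literature.Probability.Percolation.piecePos_mem_block' {n i ι : ℕ} (hn : 1 ≤ n) (hi : i < 6) (hι : ι < n) :
    blockOff n i ≤ piecePos n i ι ∧ piecePos n i ι < blockEnd n i := by
  have h := piecePos_mem_block hn hi hι
  rw [← blockEnd_eq hi] at h
  exact h

/-- **Position bounds of a six-tube window** around the pieces of lateral index `ι - 1, ι, ι + 1` of the
side `i` (`2 ≤ ι`, `ι + 3 ≤ n`): it ends inside the block of the side `i`, inside the ring. [folklore] -/
theorem _root_.Literature.Probability.Percolation.window_pos_bounds {n i ι : ℕ} (hi : i < 6) (hι1 : 2 ≤ ι) (hι2 : ι + 3 ≤ n) :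
    blockOff n i + (if i % 3 = 2 then 2 * (n - 2 - ι) else 2 * (ι - 1)) + 5 < blockEnd n i ∧ blockEnd n i ≤ 12 * n - 4 := by
  interval_cases i
  · rw [if_neg (by decide : ¬((0 : ℕ) % 3 = 2))]; simp only [blockOff, blockEnd]; omega
  · rw [if_neg (by decide : ¬((1 : ℕ) % 3 = 2))]; simp only [blockOff, blockEnd]; omega
  · rw [if_pos (by decide : (2 : ℕ) % 3 = 2)]; simp only [blockOff, blockEnd]; omega
  · rw [if_neg (by decide : ¬((3 : ℕ) % 3 = 2))]; simp only [blockOff, blockEnd]; omega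
  · rw [if_neg (by decide : ¬((4 : ℕ) % 3 = 2))]; simp only [blockOff, blockEnd]; omega
  · rw [if_pos (by decide : (5 : ℕ) % 3 = 2)]; simp only [blockOff, blockEnd]; omega

/-- `1 ≤ nB` for a valid rung. [folklore] -/
theorem _root_.Literature.Probability.Percolation.LParams.Valid.one_le_nB (hV : P.Valid) : 1 ≤ P.nB := by
  obtain ⟨hs, -, -, -, hk₀, hkμ, hrB, hrB', -, -, hnB, -, hm, -, hn, hμn, -, -⟩ := hV.facts
  refine Nat.pos_of_ne_zero fun h0 => ?_
  rw [h0, zero_mul] at hnB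
  omega

/-- `1 ≤ nW` for a valid rung. [folklore] -/
theorem _root_.Literature.Probability.Percolation.LParams.Valid.one_le_nW (hV : P.Valid) : 1 ≤ P.nW := by
  obtain ⟨hs, -, -, -, hk₀, hkμ, -, -, hrW, hrW', -, hnW, hm, -, hn, hμn, -, -⟩ := hV.facts
  refine Nat.pos_of_ne_zero fun h0 => ?_
  rw [h0, zero_mul] at hnW
  omega

/-- **The window of ring `B`** lies inside the block of the side `ic`, inside the ring. [folklore] -/
theorem windowB_facts (hV : P.Valid) (hσ : σ.InRange P) (hadm : σ.Admissible P) :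
    2 ≤ σ.ιc P ∧ σ.ιc P + 3 ≤ P.nB ∧ 1 ≤ P.nB ∧
      blockOff P.nB σ.ic ≤ σ.loB P ∧ σ.hiB P = σ.loB P + 5 ∧ σ.hiB P < blockEnd P.nB σ.ic ∧ σ.hiB P < 12 * P.nB - 4 ∧
      -(P.rB : ℤ) + (σ.ιc P : ℕ) * P.s ≤ σ.ξc P ∧ σ.ξc P < -(P.rB : ℤ) + ((σ.ιc P : ℕ) + 1) * P.s := by
  obtain ⟨hs, hw, he, hε, hk₀, hkμ, hrB, hrB', hrW, hrW', hnB, hnW, hm, hN, hn, hμn, hR₀, hR₀n⟩ := hV.facts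
  have hkc1 : P.k₀ ≤ σ.kc P := le_trapScale _ _
  have hkc2 : 32 * σ.kc P ≤ P.μ := P.scale_le hσ.hjc
  obtain ⟨-, -, ha3, ha4⟩ := hadm
  have hξc : σ.ξc P = σ.Tc P + 2 * σ.kc P + P.w := rfl
  have hnB1 := hV.one_le_nB
  have hw4 : 4 * P.w ≤ P.k₀ := by rw [hw]; omega
  -- integer facts
  have hrB1 : (P.m : ℤ) - P.μ < P.rB + P.s := by
    have : P.m - P.μ < P.rB + P.s := hrB'
    have hμm : P.μ ≤ P.m := by omega
    zify [hμm] at this; exact this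
  have hξlo : -(P.rB : ℤ) + 2 * P.s ≤ σ.ξc P := by
    have : (2 : ℤ) * σ.kc P + 0 ≥ 0 := by positivity
    have h8 : (8 : ℤ) * P.μ ≤ P.R₀ := by exact_mod_cast hR₀
    have hsμ : (P.s : ℤ) ≤ P.μ := by rw [hs]; exact_mod_cast hkμ
    omega
  have hξhi : σ.ξc P + 2 * P.s ≤ -(P.R₀ : ℤ) + P.R₀ - 0 + (2 * σ.kc P + P.w + 2 * P.s - P.R₀) + 0 := by omega
  have hspec := latIdx_spec (r := P.rB) (s := P.s) (by omega) (show -(P.rB : ℤ) ≤ σ.ξc P by omega)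
  have hι1 : 2 ≤ σ.ιc P := by
    unfold Slot.ιc latIdx
    apply (Nat.le_div_iff_mul_le (by omega)).2
    have : 2 * (P.s : ℤ) ≤ σ.ξc P + P.rB := by omega
    omega
  have hnB' : ((P.nB : ℕ) : ℤ) * P.s = P.rB := by exact_mod_cast hnB
  have hsmall : 2 * (σ.kc P : ℤ) + P.w + 3 * P.s ≤ P.R₀ := by
    have h8 : (8 : ℤ) * P.μ ≤ P.R₀ := by exact_mod_cast hR₀
    have h32 : (32 : ℤ) * σ.kc P ≤ P.μ := by exact_mod_cast hkc2
    have hw' : 4 * (P.w : ℤ) ≤ P.k₀ := by exact_mod_cast hw4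
    have hsμ : (P.s : ℤ) ≤ P.μ := by rw [hs]; exact_mod_cast hkμ
    have hkμ' : (P.k₀ : ℤ) ≤ P.μ := by exact_mod_cast hkμ
    omega
  have hι2 : σ.ιc P + 3 ≤ P.nB := by
    refine idx_le_of_mul_le (s := P.s) (c := 0) (by omega) ?_ (by omega)
    rw [Nat.cast_add, Nat.cast_ofNat]
    have h1 := hspec.1
    unfold Slot.ιc
    linarith
  obtain ⟨hhi, hhi'⟩ := window_pos_bounds (n := P.nB) hσ.hic hι1 hι2
  refine ⟨hι1, hι2, hnB1, ?_, rfl, hhi, ?_, hspec.1, hspec.2⟩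
  · unfold Slot.loB; exact Nat.le_add_right _ _
  · unfold Slot.hiB Slot.loB; exact Nat.lt_of_lt_of_le hhi hhi'

/-- **The window of ring `W`** lies inside the block of the side `3`, inside the ring, and after the
exit run of the closed arm, which spans the target rows. [folklore] -/
theorem windowW_facts (hV : P.Valid) :
    1 ≤ P.nW ∧ σ.loW P ≤ σ.hiW P ∧ σ.hiW P < 12 * P.nW - 4 ∧ blockOff P.nW 3 ≤ σ.loW P ∧ σ.hiW P < blockOff P.nW 4 ∧
      σ.xc P + P.d < P.nW ∧ 2 * (σ.xc P + P.d) < σ.loW P ∧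
      -(P.rW : ℤ) + (σ.xc P : ℕ) * P.s - P.e ≤ σ.tgc P ∧
      σ.tgc P + (P.n / 64 : ℕ) ≤ -(P.rW : ℤ) + ((σ.xc P : ℕ) + P.d) * P.s - P.e := by
  obtain ⟨hs, hw, he, hε, hk₀, hkμ, hrB, hrB', hrW, hrW', hnB, hnW, hm, hN, hn, hμn, hR₀, hR₀n⟩ := hV.facts
  have hnW1 := hV.one_le_nW
  have htgo := tgtRow_mem (n := P.n) (σ.bo P)
  have htgc := tgtRow_mem (n := P.n) (σ.bc P)
  rw [show tgtRow P.n (σ.bo P) = σ.tgo P from rfl] at htgo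
  rw [show tgtRow P.n (σ.bc P) = σ.tgc P from rfl] at htgc
  have hnW' : ((P.nW : ℕ) : ℤ) * P.s = P.rW := by exact_mod_cast hnW
  have hrW1 : (P.m : ℤ) - 3 * P.μ < P.rW + P.s := by
    have : P.m - 3 * P.μ < P.rW + P.s := hrW'
    have hμm : 3 * P.μ ≤ P.m := by omega
    zify [hμm] at this; linarith
  have hd : P.d = P.n / 64 / P.s + 3 := rfl
  have hds1 : ((P.n / 64 / P.s : ℕ) : ℤ) * P.s ≤ (P.n / 64 : ℕ) := by exact_mod_cast Nat.div_mul_le_self _ _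
  have hds2 : ((P.n / 64 : ℕ) : ℤ) < ((P.n / 64 / P.s : ℕ) : ℤ) * P.s + P.s := by exact_mod_cast Nat.lt_div_mul_add (by omega : 0 < P.s)
  have he4 : 4 * P.e ≤ P.k₀ := by rw [he]; omega
  -- the window's lateral indices
  have hyhi := latIdx_spec (r := P.rW) (s := P.s) (by omega) (show -(P.rW : ℤ) ≤ σ.tgo P + (P.n / 64 : ℕ) by omega)
  have hyHi : σ.yHi P + 1 < P.nW := by
    unfold Slot.yHi
    have : latIdx P.s P.rW (σ.tgo P + (P.n / 64 : ℕ)) + 3 ≤ P.nW := by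
      refine idx_le_of_mul_le (s := P.s) (c := 0) (by omega) ?_ (by omega)
      rw [Nat.cast_add, Nat.cast_ofNat]
      have h1 := hyhi.1
      have : 3 * (P.s : ℤ) + (P.n / 64 : ℕ) ≤ (P.n / 4 : ℕ) := by
        have : 3 * P.s + P.n / 64 ≤ P.n / 4 := by omega
        exact_mod_cast this
      linarith
    omega
  have hylo : σ.yLo P ≤ σ.yHi P := by
    unfold Slot.yLo Slot.yHi
    have := latIdx_mono (s := P.s) (r := P.rW) (show σ.tgo P - (P.n / 64 : ℕ) ≤ σ.tgo P + (P.n / 64 : ℕ) by omega)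
    omega
  -- the exit run of the closed arm
  have hspec := latIdx_spec (r := P.rW) (s := P.s) (by omega) (show -(P.rW : ℤ) ≤ σ.tgc P by omega)
  have hxc : σ.xc P = latIdx P.s P.rW (σ.tgc P) := rfl
  have hxd : σ.xc P + P.d < P.nW := by
    have : σ.xc P + P.d + 1 ≤ P.nW := by
      refine idx_le_of_mul_le (s := P.s) (c := 0) (by omega) ?_ (by omega)
      rw [Nat.cast_add, Nat.cast_add, Nat.cast_one, hd, Nat.cast_add, Nat.cast_ofNat, hxc]
      have h1 := hspec.1
      have : 5 * (P.s : ℤ) + (P.n / 64 : ℕ) ≤ (P.n / 4 : ℕ) := by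
        have : 5 * P.s + P.n / 64 ≤ P.n / 4 := by omega
        exact_mod_cast this
      nlinarith [hds1]
    omega
  refine ⟨hnW1, ?_, ?_, ?_, ?_, hxd, ?_, ?_, ?_⟩
  · unfold Slot.loW Slot.hiW; omega
  · simp only [Slot.hiW, blockOff]; omega
  · unfold Slot.loW; exact Nat.le_add_right _ _
  · simp only [Slot.hiW, blockOff]; omega
  · simp only [Slot.loW, blockOff]; omega
  · rw [hxc]; have := hspec.1; have : (0 : ℤ) ≤ P.e := by positivity
    linarith
  · rw [hxc, hd]
    simp only [Nat.cast_add, Nat.cast_ofNat]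
    have h2 := hspec.2
    have hes : (P.e : ℤ) ≤ P.s := by rw [hs]; exact_mod_cast (by omega : P.e ≤ P.k₀)
    linarith [hds1, hds2]

end Slot

/-! ### Positions from side and lateral index -/

/-- **A ring position is pinned by its side and lateral index** up to the piece/connector
ambiguity: `piecePos n i ι ≤ g ≤ piecePos n i ι + 1` where `i = ringSide g`, `ι = ringLat g`
(`1 ≤ n = r / s`, `g < 12n - 4`). [folklore] -/
theorem pos_le_of_side_lat {r s g : ℕ} (hr : 1 ≤ r / s) (hg : g < 12 * (r / s) - 4) :
    piecePos (r / s) (ringSide r s g) (ringLat r s g) ≤ g ∧ g ≤ piecePos (r / s) (ringSide r s g) (ringLat r s g) + 1 := by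
  by_cases h : g < 6 * (r / s) - 2
  · by_cases h1 : g < 2 * (r / s) - 1
    · have hsd : ringSide r s g = 0 := by unfold ringSide; rw [if_pos h, if_pos h1]
      have hlt : ringLat r s g = g / 2 := by unfold ringLat; rw [if_pos h, if_pos h1]
      rw [hsd, hlt, piecePos_eq_of_ne (by decide)]; simp only [blockOff]; omega
    · by_cases h2 : g < 4 * (r / s) - 1
      · have hsd : ringSide r s g = 1 := by unfold ringSide; rw [if_pos h, if_neg h1, if_pos h2]
        have hlt : ringLat r s g = (g - (2 * (r / s) - 1)) / 2 := by unfold ringLat; rw [if_pos h, if_neg h1, if_pos h2]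
        rw [hsd, hlt, piecePos_eq_of_ne (by decide)]; simp only [blockOff]; omega
      · have hsd : ringSide r s g = 2 := by unfold ringSide; rw [if_pos h, if_neg h1, if_neg h2]
        have hlt : ringLat r s g = r / s - 1 - (g - (4 * (r / s) - 1)) / 2 := by
          unfold ringLat; rw [if_pos h, if_neg h1, if_neg h2]
        rw [hsd, hlt, piecePos_eq_of_two (by decide)]; simp only [blockOff]; omega
  · by_cases h1 : g - (6 * (r / s) - 2) < 2 * (r / s) - 1
    · have hsd : ringSide r s g = 3 := by unfold ringSide; rw [if_neg h, if_pos h1]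
      have hlt : ringLat r s g = (g - (6 * (r / s) - 2)) / 2 := by unfold ringLat; rw [if_neg h, if_pos h1]
      rw [hsd, hlt, piecePos_eq_of_ne (by decide)]; simp only [blockOff]; omega
    · by_cases h2 : g - (6 * (r / s) - 2) < 4 * (r / s) - 1
      · have hsd : ringSide r s g = 4 := by unfold ringSide; rw [if_neg h, if_neg h1, if_pos h2]
        have hlt : ringLat r s g = (g - (6 * (r / s) - 2) - (2 * (r / s) - 1)) / 2 := by
          unfold ringLat; rw [if_neg h, if_neg h1, if_pos h2]
        rw [hsd, hlt, piecePos_eq_of_ne (by decide)]; simp only [blockOff]; omega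
      · have hsd : ringSide r s g = 5 := by unfold ringSide; rw [if_neg h, if_neg h1, if_neg h2]
        have hlt : ringLat r s g = r / s - 1 - (g - (6 * (r / s) - 2) - (4 * (r / s) - 1)) / 2 := by
          unfold ringLat; rw [if_neg h, if_neg h1, if_neg h2]
        rw [hsd, hlt, piecePos_eq_of_two (by decide)]; simp only [blockOff]; omega

/-! ### The supports as sets -/

/-- **The near set of a tip**: `frameIso i` of the slot frame box and of the spoke's box. [folklore] -/
def nearSet (i m k : ℕ) (T₀ : ℤ) (w L ε : ℕ) : Set (Site 2) :=
  frameIso i '' ((↑(slotFrame m k T₀ w) : Set (Site 2)) ∪ (spokeTube m k T₀ w L ε).box)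

/-- **The target set**: the approach box and the target box. [folklore] -/
def tgtSet (n : ℕ) (t : ℤ) (W : ℕ) : Set (Site 2) :=
  triStrip ((n : ℤ) - (n / 8 : ℕ) + 1) t W (n / 64) ∪ triStrip ((n : ℤ) - (n / 8 : ℕ) + 1) (t - (n / 64 : ℕ)) (n / 8 - 2) (2 * (n / 64))

/-- The support of a corridor, as a set. [folklore] -/
theorem coe_corrFin (i m n k : ℕ) (T₀ : ℤ) (w L ε r e s a len : ℕ) (t : ℤ) (W : ℕ) :
    (↑(corrFin i m n k T₀ w L ε r e s a len t W) : Set (Site 2)) =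
      nearSet i m k T₀ w L ε ∪ boxAll (arc (thinRing r e s) a len) ∪ tgtSet n t W := by
  unfold corrFin nearSet tgtSet
  rw [Finset.coe_union, Finset.coe_union, Finset.coe_union, Finset.coe_image, Finset.coe_union, coe_sites, coe_sitesAll,
    coe_triStripFinset, coe_triStripFinset, Set.union_assoc]

/-! ### Where the pieces are -/

/-- **Where the near set is** (frame coordinates): a point of `nearSet i m k T₀ w L ε` is
`frameIso i u` with `m - 2k + 1 - L ≤ u₀ ≤ m - 1`... and `T₀ + 1 ≤ u₁ ≤ T₀ + w + 4k` (`1 ≤ k`,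
`1 ≤ ε`, `4ε ≤ k`... precisely `ε + 1 ≤ 2k`, `5k ≤ 2k - 1 + L`... we only record the bounds). [folklore] -/
theorem exists_of_mem_nearSet {i m k : ℕ} {T₀ : ℤ} {w L ε : ℕ} (hk : 1 ≤ k) (hε : ε ≤ k) (hL : 3 * k + 1 ≤ L)
    {v : Site 2} (hv : v ∈ nearSet i m k T₀ w L ε) :
    ∃ u : Site 2, v = frameIso i u ∧ (m : ℤ) - 2 * k + 1 - L ≤ u 0 ∧ u 0 ≤ (m : ℤ) - 1 ∧ T₀ + 1 ≤ u 1 ∧ u 1 ≤ T₀ + w + 4 * k := by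
  obtain ⟨u, hu, rfl⟩ := hv
  refine ⟨u, rfl, ?_⟩
  rcases hu with hu | hu
  · rw [Finset.mem_coe, mem_slotFrame hk] at hu; omega
  · rw [Tube.mem_box] at hu
    simp only [spokeTube, bcnCentre, site_mk_apply_zero, site_mk_apply_one] at hu
    push_cast at hu
    have : 4 * ((k / 4 : ℕ) : ℤ) ≤ k := by omega
    have hε' : (ε : ℤ) ≤ k := by exact_mod_cast hε
    omega

/-- Points of the slot frame box part of the near set are deep at most `5k`. [folklore] -/
theorem exists_of_mem_image_slotFrame {i m k : ℕ} {T₀ : ℤ} {w : ℕ} (hk : 1 ≤ k) {v : Site 2}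
    (hv : v ∈ frameIso i '' (↑(slotFrame m k T₀ w) : Set (Site 2))) :
    ∃ u : Site 2, v = frameIso i u ∧ (m : ℤ) - 5 * k ≤ u 0 ∧ u 0 ≤ (m : ℤ) - 1 ∧ T₀ + 1 ≤ u 1 ∧ u 1 ≤ T₀ + w + 4 * k := by
  obtain ⟨u, hu, rfl⟩ := hv
  rw [Finset.mem_coe, mem_slotFrame hk] at hu
  exact ⟨u, rfl, hu.1, hu.2.1, hu.2.2.1, hu.2.2.2⟩

/-- Points of the spoke part of the near set have lateral coordinate within `ε` of `ξ = T₀ + 2k + w`. [folklore] -/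
theorem exists_of_mem_image_spokeBox {i m k : ℕ} {T₀ : ℤ} {w L ε : ℕ} {v : Site 2}
    (hv : v ∈ frameIso i '' (spokeTube m k T₀ w L ε).box) :
    ∃ u : Site 2, v = frameIso i u ∧ (m : ℤ) - 2 * k + 1 - L ≤ u 0 ∧ u 0 ≤ (m : ℤ) - 2 * k + 1 + (k / 4 : ℕ) ∧
      T₀ + 2 * k + w - ε ≤ u 1 ∧ u 1 ≤ T₀ + 2 * k + w + ε := by
  obtain ⟨u, hu, rfl⟩ := hv
  rw [Tube.mem_box] at hu
  simp only [spokeTube, bcnCentre, site_mk_apply_zero, site_mk_apply_one] at hu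
  push_cast at hu
  exact ⟨u, rfl, by omega, by omega, by omega, by omega⟩

/-- **Where the target set is**: `x₀ ∈ [n - n/8 + 1, n - n/8 + 1 + W]`, `x₁ ∈ [t - n/64, t + n/64]` (`16 ≤ n`). [folklore] -/
theorem bounds_of_mem_tgtSet {n : ℕ} (hn : 16 ≤ n) {t : ℤ} {W : ℕ} (hW : n / 8 ≤ W) {v : Site 2} (hv : v ∈ tgtSet n t W) :
    (n : ℤ) - (n / 8 : ℕ) + 1 ≤ v 0 ∧ v 0 ≤ (n : ℤ) - (n / 8 : ℕ) + 1 + W ∧ t - (n / 64 : ℕ) ≤ v 1 ∧ v 1 ≤ t + (n / 64 : ℕ) := by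
  have h8 : ((n / 8 - 2 : ℕ) : ℤ) = (n / 8 : ℕ) - 2 := by omega
  have hW' : ((n / 8 : ℕ) : ℤ) ≤ W := by exact_mod_cast hW
  rcases hv with hv | hv <;> rw [mem_triStrip] at hv
  · omega
  · rw [h8] at hv; omega

/-! ### The pieces, pairwise -/

/-- **Near sets of the two colours are disjoint**: on a common side by the row gap (`SepOK`), on
different sides by sectors. [folklore] -/
theorem nearSet_disjoint_nearSet {io ic m : ℕ} (hio : io < 6) (hic : ic < 6) {ko kc : ℕ} {To Tc : ℤ} {w LB LW ε R₀ : ℕ}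
    (hko : 1 ≤ ko) (hkc : 1 ≤ kc) (hεo : ε ≤ ko) (hεc : ε ≤ kc) (hLo : 3 * ko + 1 ≤ LB)
    (hLc : 3 * kc + 1 ≤ LW) (hadm : To ≤ -(R₀ : ℤ) ∧ -(m : ℤ) + R₀ < To + w ∧ Tc ≤ -(R₀ : ℤ) ∧ -(m : ℤ) + R₀ < Tc + w)
    (hlam : (LB : ℤ) + LW + 4 * ko + 4 * kc + 2 * w < 2 * R₀) (hwk : 2 * (w : ℤ) ≤ 4 * ko ∧ 2 * (w : ℤ) ≤ 4 * kc)
    (hsep : io ≠ ic ∨ To + 8 * ko < Tc + w ∨ Tc + 8 * kc < To + w)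
    {v : Site 2} (hvo : v ∈ nearSet io m ko To w LB ε) (hvc : v ∈ nearSet ic m kc Tc w LW ε) : False := by
  obtain ⟨uo, rfl, ho0, ho0', ho1, ho1'⟩ := exists_of_mem_nearSet hko hεo hLo hvo
  obtain ⟨uc, huc, hc0, hc0', hc1, hc1'⟩ := exists_of_mem_nearSet hkc hεc hLc hvc
  by_cases hii : io = ic
  · subst hii
    have : uo = uc := (frameIso io).injective huc
    subst this
    rcases hsep with h | h | h
    · exact h rfl
    · omega
    · omega
  · have hso : frameIso io uo ∈ sectorNear io ((R₀ : ℤ) - (LB + 4 * ko + w)) :=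
      (frameIso_mem_sectorNear_iff hio).2 ⟨by omega, by omega⟩
    have hsc : frameIso ic uc ∈ sectorNear ic ((R₀ : ℤ) - (LW + 4 * kc + w)) :=
      (frameIso_mem_sectorNear_iff hic).2 ⟨by omega, by omega⟩
    rw [← huc] at hsc
    exact Set.disjoint_left.1 (disjoint_sectorNear hio hic hii (by omega)) hso hsc

/-- **Ring tubes outside the spoke's window avoid the spoke.** A point of a ring tube
`ringTube r e s g` (`g` outside the six positions `[lo, lo + 5]` of the pieces of lateral index
`ιc - 1, ιc, ιc + 1` of the side `ic` and their connectors) is not a point of the spoke of a tip of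
the frame `ic` with lateral position `ξ`, `-r + ιc s ≤ ξ < -r + (ιc + 1) s`, provided the spoke
keeps a sector margin `lam > 2e` and `e + ε < s`. [folklore] -/
theorem ringTube_disjoint_spoke {r e s g ic m kc : ℕ} {Tc : ℤ} {w LW ε ιc : ℕ} (hr : 1 ≤ r / s) (hsr : s ∣ r) (he : 2 * e ≤ r)
    (hg : g < 12 * (r / s) - 4) (hic : ic < 6) (hι1 : 1 ≤ ιc) (hι2 : ιc + 2 ≤ r / s)
    (hout : g < blockOff (r / s) ic + (if ic % 3 = 2 then 2 * (r / s - 2 - ιc) else 2 * (ιc - 1)) ∨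
      blockOff (r / s) ic + (if ic % 3 = 2 then 2 * (r / s - 2 - ιc) else 2 * (ιc - 1)) + 5 < g)
    (hξ : -(r : ℤ) + ιc * s ≤ Tc + 2 * kc + w ∧ Tc + 2 * kc + w < -(r : ℤ) + (ιc + 1) * s) (hes : (e : ℤ) + ε < s)
    {lam : ℤ} (hlam : 2 * (e : ℤ) < lam) (hlam1 : Tc + 2 * kc + w + ε ≤ -lam) (hlam2 : lam ≤ (m : ℤ) - 2 * kc + 1 - LW + (Tc + 2 * kc + w) - ε)
    {v : Site 2} (hv : v ∈ (ringTube r e s g).box) (hv' : v ∈ frameIso ic '' (spokeTube m kc Tc w LW ε).box) : False := by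
  obtain ⟨u, rfl, hu0, hu0', hu1, hu1'⟩ := exists_of_mem_image_spokeBox hv'
  obtain ⟨hsec, hl1, hl2, -, -⟩ := ringTube_bounds hr hsr he hg hv
  have hsc : frameIso ic u ∈ sectorNear ic lam := (frameIso_mem_sectorNear_iff hic).2 ⟨by omega, by omega⟩
  by_cases hside : ringSide r s g = ic
  · rw [hside, lat_frameIso hic] at hl1 hl2
    -- the lateral index of the tube is within one of `ιc`
    have hι : ιc - 1 ≤ ringLat r s g ∧ ringLat r s g ≤ ιc + 1 := by
      have hs0 : (0 : ℤ) < s := by omega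
      constructor
      · by_contra h
        push Not at h
        have : ((ringLat r s g : ℕ) : ℤ) + 2 ≤ ιc := by omega
        nlinarith
      · by_contra h
        push Not at h
        have : (ιc : ℤ) + 2 ≤ ringLat r s g := by exact_mod_cast h
        nlinarith
    have hpos := pos_le_of_side_lat hr hg
    rw [hside] at hpos
    unfold piecePos at hpos
    rcases hout with hout | hout <;> split_ifs at hout hpos <;> omega
  · exact Set.disjoint_left.1 (disjoint_sectorNear (ringSide_lt r s g) hic hside (by omega)) hsec hsc

/-- **The target set avoids the near set of the other colour** on a different side, by sectors
(`16 ≤ n`... and the target rows in `[-n + n/4, -n/4]`). [folklore] -/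
theorem tgtSet_disjoint_nearSet_of_ne {n ic m kc : ℕ} {t Tc : ℤ} {W w LW ε R₀ : ℕ} (hic : ic < 6) (hic0 : ic ≠ 0) (hn : 16 ≤ n)
    (hW : n / 8 ≤ W)
    (ht : -(n : ℤ) + (n / 4 : ℕ) ≤ t ∧ t ≤ -((n / 4 : ℕ) : ℤ)) (hkc : 1 ≤ kc) (hεc : ε ≤ kc) (hLc : 3 * kc + 1 ≤ LW)
    (hadm : Tc ≤ -(R₀ : ℤ) ∧ -(m : ℤ) + R₀ < Tc + w) (hlam : (LW : ℤ) + 4 * kc + w < R₀ + ((n / 4 : ℕ) : ℤ) - (n / 8 : ℕ) - (n / 64 : ℕ))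
    {v : Site 2} (hv : v ∈ tgtSet n t W) (hv' : v ∈ nearSet ic m kc Tc w LW ε) : False := by
  obtain ⟨h0, -, h1, h1'⟩ := bounds_of_mem_tgtSet hn hW hv
  obtain ⟨uc, huc, hc0, -, hc1, hc1'⟩ := exists_of_mem_nearSet hkc hεc hLc hv'
  have hs0 : v ∈ sectorNear 0 (((n / 4 : ℕ) : ℤ) - (n / 8 : ℕ) - (n / 64 : ℕ)) := by
    simp only [sectorNear, Set.mem_setOf_eq]; omega
  have hsc : frameIso ic uc ∈ sectorNear ic ((R₀ : ℤ) - (LW + 4 * kc + w)) :=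
    (frameIso_mem_sectorNear_iff hic).2 ⟨by omega, by omega⟩
  rw [← huc] at hsc
  exact Set.disjoint_left.1 (disjoint_sectorNear (by norm_num) hic (Ne.symm hic0) (by omega)) hs0 hsc

/-- **Ring tubes outside the target's window avoid the reflected target set.** A point `u` of a tube
`ringTube r e s g` of the ring of the closed arm with `g` outside the positions `[lo, hi]` of the side
`3` whose lateral indices cover `[yLo, yHi]` is not the reflection of a point of the target set at
row `t` of the open arm (`16 ≤ n`, margins). [folklore] -/
theorem ringTube_disjoint_neg_tgtSet {r e s g n : ℕ} {t : ℤ} {W : ℕ} (hr : 1 ≤ r / s) (hsr : s ∣ r) (he : 2 * e ≤ r)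
    (hg : g < 12 * (r / s) - 4) (hn : 16 ≤ n) (hW : n / 8 ≤ W) (ht : -(n : ℤ) + (n / 4 : ℕ) ≤ t ∧ t ≤ -((n / 4 : ℕ) : ℤ))
    (hlam : 2 * (e : ℤ) < ((n / 4 : ℕ) : ℤ) - (n / 8 : ℕ) - (n / 64 : ℕ)) (hs : 1 ≤ s) (hes : (e : ℤ) < s)
    (htr : -(r : ℤ) ≤ t - (n / 64 : ℕ))
    (hout : g < blockOff (r / s) 3 + 2 * (latIdx s r (t - (n / 64 : ℕ)) - 1) ∨ blockOff (r / s) 3 + 2 * (latIdx s r (t + (n / 64 : ℕ)) + 1) + 1 < g)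
    {u : Site 2} (hu : u ∈ (ringTube r e s g).box) (hu' : -u ∈ tgtSet n t W) : False := by
  obtain ⟨h0, -, h1, h1'⟩ := bounds_of_mem_tgtSet hn hW hu'
  simp only [Pi.neg_apply] at h0 h1 h1'
  obtain ⟨hsec, hl1, hl2, -, -⟩ := ringTube_bounds hr hsr he hg hu
  have hs3 : u ∈ sectorNear 3 (((n / 4 : ℕ) : ℤ) - (n / 8 : ℕ) - (n / 64 : ℕ)) := by
    simp only [sectorNear, Set.mem_setOf_eq]; omega
  by_cases hside : ringSide r s g = 3
  · rw [hside] at hl1 hl2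
    simp only [lat] at hl1 hl2
    have hlo := latIdx_spec (r := r) hs htr
    have hhi := latIdx_spec (r := r) hs (show -(r : ℤ) ≤ t + (n / 64 : ℕ) by omega)
    have hι : latIdx s r (t - (n / 64 : ℕ)) - 1 ≤ ringLat r s g ∧ ringLat r s g ≤ latIdx s r (t + (n / 64 : ℕ)) + 1 := by
      have hs0 : (0 : ℤ) < s := by omega
      constructor
      · by_contra h
        push Not at h
        have : ((ringLat r s g : ℕ) : ℤ) + 2 ≤ latIdx s r (t - (n / 64 : ℕ)) := by omega
        nlinarith
      · by_contra h
        push Not at h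
        have : ((latIdx s r (t + (n / 64 : ℕ)) : ℕ) : ℤ) + 2 ≤ ringLat r s g := by exact_mod_cast h
        nlinarith
    have hpos := pos_le_of_side_lat hr hg
    rw [hside] at hpos
    unfold piecePos at hpos
    simp only [show (3 : ℕ) % 3 = 0 from rfl, show (0 : ℕ) ≠ 2 from by decide, if_false] at hpos
    rcases hout with hout | hout <;> omega
  · exact Set.disjoint_left.1 (disjoint_sectorNear (ringSide_lt r s g) (by norm_num) hside (by omega)) hsec hs3

end Literature.Probability.Percolation
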